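import Literature.NumberTheory.EllipticCurves.BigRepModuleShapiroInjectiveProofs
import Mathlib.NumberTheory.Padics.RingHoms
import HarnessLib

/-!
# Shapiro's map for the co-induced module `M = A ⊗ Λ^*(Ψ⁻¹)` at a FINITELY DECOMPOSED place:
# a cocycle of `bigRep κ ρ` on a compact group `D` with `κ(D) = p^e ℤ_p` is a coboundary iff all its
# evaluations are coboundaries on `D ∩ ker κ` — PROVED

Topic `Literature/NumberTheory/EllipticCurves`. Theorems only: no definition, no named fact, no
`sorry`, no instance, no notation. Cell `bsd-stepL`, seat `bsd-stepL-imc-p1` (g11): module M3b of the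
tree-mapped discharge plan `NOTE-prop323-Shapiro-discharge-plan-imc-p1-g11` for the named fact
`SkinnerUrban2014.prop323_XAc_equiv_XBigDecomp` ([SU14] Prop. 3.2.3): the LOCAL Shapiro lemma at a
decomposition group `D = D_v ≤ Γ_K` whose image in `Γ = ℤ_p` is OPEN (`κ(D_v) = p^e ℤ_p`: the place `v`
is finitely decomposed in `K_∞/K` — e.g. the primes above `p` and the primes of `K` split in `K/ℚ` for
the anticyclotomic tower), complementing `BigRepModuleShapiroLocalSplitProofs.lean` (M3a: `κ(D_v) = 1`,
totally split places) and generalising `BigRepModuleShapiroInjectiveProofs.lean` (M1: `e = 0`).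

## What is proved (generic: `D` a compact topological group, `κ : D →ₜ* ℤ_p` with
## `toAdd ∘ κ` ONTO `p^e ℤ_p`, `ρ` continuous on a discrete `p`-primary `A`, `c` a continuous cocycle)

**`exists_eq_bigRep_sub_iff_forall_apply_of_image_eq`**: `c` is a coboundary of `bigRep κ ρ`
(`∃ Φ, c(g) = g·Φ − Φ`) IFF for every `x ∈ ℤ_p` the evaluation `h ↦ c(h)(x)` restricted to `ker κ` is a
coboundary of `ρ` (`∃ a_x, c(h)(x) = ρ(h)a_x − a_x` for `κ h = 1`). Together with
`conj_apply_zero_eq_apply` (M3a: the conjugates `conj_σ` of the Shapiro image ARE these evaluations at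
`x = κ σ`, up to coboundaries) this is SU14 (3.1.2.a)–(3.1.2.b) at a finitely decomposed place: the
big class dies on `D_v` iff the Shapiro class dies on `ker κ ∩ D_{v'}` for every place `v'` of `K_∞`
above `v`.
Proof (⟸, generalising M1): with `r(x) = (x mod p^e) ∈ [0, p^e)` (`PadicInt.toZModPow`) and primitives
`a_b` at the base points, `Φ(b + κ g) := ρ(g) a_b − c(g)(b + κ g)` for `r b = b` — well defined
(`primitiveVal_mul_of_ker`), read through the continuous surjection `q : D × {b : r b = b} → ℤ_p`,
`(g, b) ↦ b + κ g` (compact onto Hausdorff, hence a quotient map) so that `Φ` is continuous, then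
smooth (`exists_isSmoothOfLevel_of_continuous`) and uniformly `p`-primary (`exists_uniform_pow_smul_eq_zero`);
the identity `c(δ) = δ·Φ − Φ` is the cocycle identity `c(g_x) = c(δ) + δ·c(δ⁻¹ g_x)` read at `x`.

HONEST FRAMING: group cohomology of an induced module; nothing about elliptic curves or BSD; the named
fact `prop323_…` is NOT discharged by this file.

References: [SkinnerUrban2014] §3.1.2 ((3.1.2.a)–(3.1.2.b)), Prop. 3.2.3; [SerreGaloisCohomology1997] I §2.5;
[GreenbergLNM1716] §1 (finitely decomposed primes). Tree: M1 `BigRepModuleShapiroInjectiveProofs.lean`.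
-/

noncomputable section

open Multiplicative Topology Filter
open Literature.NumberTheory.GaloisRepresentations

namespace Literature.NumberTheory.EllipticCurves.BigRepModule

universe u

variable {𝒪 : Type*} [CommRing 𝒪] {p : ℕ} [hp : Fact p.Prime] {A : Type u} [AddCommGroup A] [Module 𝒪 A]
  [TopologicalSpace 𝒪] [TopologicalSpace A] [DiscreteTopology A]
  {D : Type u} [Group D] [TopologicalSpace D] [IsTopologicalGroup D] [TopologicalSpace (PowerSeries 𝒪)]
  {κ : D →ₜ* Multiplicative ℤ_[p]} {ρ : ContinuousRep D 𝒪 A}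

/-! ## §1 The base-pointed primitive `(g, b) ↦ ρ(g) a_b − c(g)(b + κ g)` -/

/-- Well-definedness of the base-pointed primitive: for `κ h = 1` and `c(h)(b) = ρ(h)a − a`,
`ρ(g h) a − c(g h)(b + κ(g h)) = ρ(g) a − c(g)(b + κ g)`. [cite: SkinnerUrban2014, Prop. 3.2.3 (proof)] -/
theorem primitiveVal_mul_of_ker {c : D → BigRepModule 𝒪 p A}
    (hc : ∀ g h : D, c (g * h) = c g + bigRep κ ρ g (c h)) {b : ℤ_[p]} {a : A}
    (ha : ∀ h : D, κ h = 1 → c h b = ρ h a - a) (g : D) {h : D} (hh : κ h = 1) :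
    ρ (g * h) a - c (g * h) (b + (κ (g * h)).toAdd) = ρ g a - c g (b + (κ g).toAdd) := by
  have hκ : (κ (g * h)).toAdd = (κ g).toAdd := by rw [map_mul, hh, mul_one]
  rw [hκ, hc, BigRepModule.add_apply, bigRep_apply_apply, add_sub_cancel_right, ha h hh, map_mul,
    Module.End.mul_apply, map_sub]
  abel

omit [IsTopologicalGroup D] [TopologicalSpace (PowerSeries 𝒪)] in
/-- Continuity of `(g, b) ↦ ρ(g) a_b − c(g)(b + κ g)` on `D × R` for a discrete index space `R` of base
points (`A` discrete, `c` locally constant, each `c(g)` continuous on `ℤ_p`). [cite: SkinnerUrban2014, Prop. 3.2.3 (proof)] -/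
theorem continuous_primitiveVal {R : Type*} [TopologicalSpace R] [DiscreteTopology R]
    {c : D → BigRepModule 𝒪 p A} (hcont : Continuous c) (a : R → A) (ι : R → ℤ_[p]) :
    Continuous fun z : D × R ↦ ρ z.1 (a z.2) - c z.1 (ι z.2 + (κ z.1).toAdd) := by
  have hκ : Continuous fun g : D ↦ (κ g).toAdd := continuous_toAdd.comp κ.continuous_toFun
  have h1 : Continuous fun z : D × R ↦ ρ z.1 (a z.2) :=
    ρ.continuous_smul.comp (continuous_fst.prodMk ((continuous_of_discreteTopology (f := a)).comp
      continuous_snd))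
  have h2 : Continuous fun z : D × R ↦ c z.1 (ι z.2 + (κ z.1).toAdd) := by
    refine continuous_iff_continuousAt.2 fun z₀ ↦ ?_
    have hlc : ∀ᶠ z : D × R in 𝓝 z₀, c z.1 = c z₀.1 := by
      have := ((IsLocallyConstant.iff_eventually_eq c).1
        ((IsLocallyConstant.iff_continuous c).2 hcont)) z₀.1
      exact (continuous_fst.tendsto z₀).eventually this
    have harg : Continuous fun z : D × R ↦ ι z.2 + (κ z.1).toAdd :=
      ((continuous_of_discreteTopology (f := ι)).comp continuous_snd).add (hκ.comp continuous_fst)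
    have h₀ : ContinuousAt (fun z : D × R ↦ c z₀.1 (ι z.2 + (κ z.1).toAdd)) z₀ :=
      ((continuous_coe (c z₀.1)).comp harg).continuousAt
    refine h₀.congr ?_
    filter_upwards [hlc] with z hz
    rw [hz]
  exact h1.sub h2

/-! ## §2 The local Shapiro lemma for an open image -/

/-- **LOCAL SHAPIRO AT A FINITELY DECOMPOSED PLACE (open image `p^e ℤ_p`).** Let `D` be a compact
topological group, `κ : D → ℤ_p` a continuous homomorphism with `κ(D) = p^e ℤ_p` (`hI`, `hsurj`), `ρ`
a continuous `𝒪`-linear representation of `D` on a discrete `p`-primary `A`, and `c : D → M` a continuous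
1-cocycle of `bigRep κ ρ`. Then `c` is a coboundary iff, for every `x ∈ ℤ_p`, `h ↦ c(h)(x)` is a
coboundary of `ρ` on `ker κ`. [cite: SkinnerUrban2014, §3.1.2 ((3.1.2.a)–(3.1.2.b)) and Prop. 3.2.3]
[cite: SerreGaloisCohomology1997, I §2.5 (Shapiro's lemma)] -/
theorem exists_eq_bigRep_sub_iff_forall_apply_of_image_eq [CompactSpace D]
    (hA : ∀ a : A, ∃ k : ℕ, p ^ k • a = 0) {e : ℕ}
    (hI : ∀ g : D, (κ g).toAdd ∈ Ideal.span {(p : ℤ_[p]) ^ e})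
    (hsurj : ∀ y ∈ Ideal.span {(p : ℤ_[p]) ^ e}, ∃ g : D, (κ g).toAdd = y)
    {c : D → BigRepModule 𝒪 p A} (hcont : Continuous c)
    (hc : ∀ g h : D, c (g * h) = c g + bigRep κ ρ g (c h)) :
    (∃ Φ : BigRepModule 𝒪 p A, ∀ g : D, c g = bigRep κ ρ g Φ - Φ) ↔
      ∀ x : ℤ_[p], ∃ a : A, ∀ h : D, κ h = 1 → c h x = ρ h a - a := by
  classical
  constructor
  · rintro ⟨Φ, hΦ⟩ x
    refine ⟨Φ x, fun h hh ↦ ?_⟩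
    rw [hΦ h, BigRepModule.sub_apply, bigRep_apply_apply, hh, toAdd_one, sub_zero]
  intro hloc
  choose a ha using hloc
  -- ### base points: `ZMod (p^e)` read in `ℤ_p`; `x ↦ x mod p^e`
  haveI : NeZero (p ^ e) := ⟨pow_ne_zero e hp.out.ne_zero⟩
  letI : TopologicalSpace (ZMod (p ^ e)) := ⊥
  haveI : DiscreteTopology (ZMod (p ^ e)) := ⟨rfl⟩
  have hval : ∀ x : ℤ_[p], x - ((PadicInt.toZModPow e x).val : ℤ_[p]) ∈ Ideal.span {(p : ℤ_[p]) ^ e} := by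
    intro x
    rw [← PadicInt.ker_toZModPow, RingHom.mem_ker, map_sub, map_natCast, ZMod.natCast_zmod_val, sub_self]
  have htval : ∀ t : ZMod (p ^ e), PadicInt.toZModPow e ((t.val : ℕ) : ℤ_[p]) = t := fun t ↦ by
    rw [map_natCast, ZMod.natCast_zmod_val]
  -- ### the two-variable primitive `F (g, t) = ρ g a_t − c g (t + κ g)` and `q (g, t) = t + κ g`
  set F : D × ZMod (p ^ e) → A :=
    fun z ↦ ρ z.1 (a (z.2.val : ℤ_[p])) - c z.1 ((z.2.val : ℤ_[p]) + (κ z.1).toAdd) with hF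
  set q : D × ZMod (p ^ e) → ℤ_[p] := fun z ↦ (z.2.val : ℤ_[p]) + (κ z.1).toAdd with hq
  -- `F` factors through `q`
  have hFq : ∀ z z' : D × ZMod (p ^ e), q z = q z' → F z = F z' := by
    rintro ⟨g, t⟩ ⟨g', t'⟩ hzz
    change (t.val : ℤ_[p]) + (κ g).toAdd = (t'.val : ℤ_[p]) + (κ g').toAdd at hzz
    -- same base point
    have htt : t = t' := by
      have h1 : (t.val : ℤ_[p]) - (t'.val : ℤ_[p]) ∈ Ideal.span {(p : ℤ_[p]) ^ e} := by
        have : (t.val : ℤ_[p]) - (t'.val : ℤ_[p]) = (κ g').toAdd - (κ g).toAdd := by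
          linear_combination hzz
        rw [this]
        exact Ideal.sub_mem _ (hI g') (hI g)
      have h2 : PadicInt.toZModPow e ((t.val : ℤ_[p]) - (t'.val : ℤ_[p])) = 0 := by
        rw [← RingHom.mem_ker, PadicInt.ker_toZModPow]; exact h1
      rwa [map_sub, htval, htval, sub_eq_zero] at h2
    subst htt
    have hκκ : (κ g).toAdd = (κ g').toAdd := add_left_cancel hzz
    have hk : κ (g⁻¹ * g') = 1 := by
      apply toAdd.injective
      rw [map_mul, map_inv, toAdd_mul, toAdd_inv, ← hκκ, neg_add_cancel, toAdd_one]
    change ρ g (a (t.val : ℤ_[p])) - c g ((t.val : ℤ_[p]) + (κ g).toAdd) =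
      ρ g' (a (t.val : ℤ_[p])) - c g' ((t.val : ℤ_[p]) + (κ g').toAdd)
    have := primitiveVal_mul_of_ker hc (ha (t.val : ℤ_[p])) g hk
    rw [mul_inv_cancel_left] at this
    exact this.symm
  -- a section of `q`: `x = (x mod p^e) + κ g_x`
  have hsec : ∀ x : ℤ_[p], ∃ z : D × ZMod (p ^ e), q z = x := by
    intro x
    obtain ⟨g, hg⟩ := hsurj _ (hval x)
    exact ⟨(g, PadicInt.toZModPow e x), by
      change ((PadicInt.toZModPow e x).val : ℤ_[p]) + (κ g).toAdd = x; rw [hg]; abel⟩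
  choose sz hsz using hsec
  set Φf : ℤ_[p] → A := fun x ↦ F (sz x) with hΦf
  have hΦF : ∀ z : D × ZMod (p ^ e), Φf (q z) = F z := fun z ↦ hFq _ _ (hsz (q z))
  -- ### continuity of `Φf`: `Φf ∘ q = F` is continuous and `q` is a quotient map (compact → T₂, onto)
  have hqc : Continuous q :=
    ((continuous_of_discreteTopology (f := fun t : ZMod (p ^ e) ↦ (t.val : ℤ_[p]))).comp
      continuous_snd).add ((continuous_toAdd.comp κ.continuous_toFun).comp continuous_fst)
  have hquot : IsQuotientMap q := (hqc.isClosedMap).isQuotientMap hqc fun x ↦ ⟨sz x, hsz x⟩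
  have hΦc : Continuous Φf := by
    rw [hquot.continuous_iff]
    have : Φf ∘ q = F := funext fun z ↦ hΦF z
    rw [this]
    exact continuous_primitiveVal hcont (fun t : ZMod (p ^ e) ↦ a (t.val : ℤ_[p]))
      (fun t : ZMod (p ^ e) ↦ (t.val : ℤ_[p]))
  -- ### `Φf ∈ M`
  obtain ⟨n, hn⟩ := exists_isSmoothOfLevel_of_continuous hΦc
  have htor : ∀ x : ℤ_[p], ∃ k : ℕ, p ^ k • Φf x = 0 := by
    intro x
    obtain ⟨k₁, hk₁⟩ := hA (a ((sz x).2.val : ℤ_[p]))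
    obtain ⟨k₂, hk₂⟩ := (c (sz x).1).exists_torsion
    refine ⟨k₁ + k₂, ?_⟩
    have h₁ : p ^ (k₁ + k₂) • ρ (sz x).1 (a ((sz x).2.val : ℤ_[p])) = 0 := by
      rw [pow_add, mul_comm, mul_smul, ← map_nsmul, hk₁, map_zero, smul_zero]
    have h₂ : p ^ (k₁ + k₂) • c (sz x).1 (((sz x).2.val : ℤ_[p]) + (κ (sz x).1).toAdd) = 0 := by
      rw [pow_add, mul_smul, hk₂, smul_zero]
    change p ^ (k₁ + k₂) • (ρ (sz x).1 (a ((sz x).2.val : ℤ_[p])) -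
      c (sz x).1 (((sz x).2.val : ℤ_[p]) + (κ (sz x).1).toAdd)) = 0
    rw [smul_sub, h₁, h₂, sub_zero]
  obtain ⟨k, hk⟩ := exists_uniform_pow_smul_eq_zero
    (((IsLocallyConstant.iff_continuous Φf).2 hΦc).range_finite) htor
  refine ⟨BigRepModule.mk Φf ⟨⟨n, hn⟩, ⟨k, hk⟩⟩, fun δ ↦ ?_⟩
  -- ### `c δ = δ·Φ − Φ`, read at `x = q (g_x, t_x)`
  ext x
  obtain ⟨⟨gx, tx⟩, rfl⟩ : ∃ z : D × ZMod (p ^ e), q z = x := ⟨sz x, hsz x⟩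
  -- `x − κ δ = q (δ⁻¹ gx, tx)`
  have hshift : (tx.val : ℤ_[p]) + (κ gx).toAdd - (κ δ).toAdd = q (δ⁻¹ * gx, tx) := by
    change _ = (tx.val : ℤ_[p]) + (κ (δ⁻¹ * gx)).toAdd
    rw [map_mul, map_inv, toAdd_mul, toAdd_inv]; abel
  rw [BigRepModule.sub_apply, bigRep_apply_apply, BigRepModule.mk_apply, BigRepModule.mk_apply]
  change c δ ((tx.val : ℤ_[p]) + (κ gx).toAdd) =
    ρ δ (Φf ((tx.val : ℤ_[p]) + (κ gx).toAdd - (κ δ).toAdd)) - Φf (q (gx, tx))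
  rw [hshift, hΦF, hΦF]
  simp only [hF]
  -- cocycle identity `c gx = c δ + δ · c (δ⁻¹ gx)`
  have hcoc : c gx = c δ + bigRep κ ρ δ (c (δ⁻¹ * gx)) := by rw [← hc, mul_inv_cancel_left]
  have hval' := congrArg (fun Ψ : BigRepModule 𝒪 p A ↦ Ψ ((tx.val : ℤ_[p]) + (κ gx).toAdd)) hcoc
  simp only [BigRepModule.add_apply, bigRep_apply_apply] at hval'
  have harg : (tx.val : ℤ_[p]) + (κ gx).toAdd - (κ δ).toAdd = (tx.val : ℤ_[p]) + (κ (δ⁻¹ * gx)).toAdd := by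
    rw [map_mul, map_inv, toAdd_mul, toAdd_inv]; abel
  rw [harg] at hval'
  rw [map_sub, ← Module.End.mul_apply, ← map_mul, mul_inv_cancel_left, hval']
  abel

end Literature.NumberTheory.EllipticCurves.BigRepModule

end
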